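import Literature.Probability.LatticeModels.ZnGinibreFrustrationBound
import Literature.Probability.LatticeModels.IsingTorusPeierls
import Literature.MathematicalPhysics.QuantumFieldTheory.FiniteTemperatureConfinementWindows
import HarnessLib

/-!
# `ℤ_n` lattice gauge theory deconfines at non-zero temperature in every space dimension `d ≥ 2`
# (every `n ≥ 2`, every temporal extent), by Griffiths' inequalities and Peierls' argument

Companion of `AbelianFiniteTemperatureDeconfinement.lean` (Borgs–Seiler's abelian route, `d ≥ 3`, via
the infrared bound, threshold linear in `L₀`) and of `Z2FiniteTemperatureDeconfinementD2.lean`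
(`ℤ₂`, `d = 2`, via the exact Ising reduction and Peierls). On Borgs–Seiler's finite-temperature lattice
`ℤ_{L₀} × (ℤ/L)^d` (`Literature.Barriers.QuantumFields.FiniteTemperature`: time-like plaquette coupling
`J_E`, space-like coupling `J_M`, Polyakov-loop two-point function `G_L(x) = polyakovCorrelation ρ J_E J_M x`)
we PROVE, for the gauge group `ℤ_n = rootsOfUnityCircle n ⊂ U(1)` with its faithful character `znRep n`,
EVERY `n ≥ 2`, EVERY space dimension `d ≥ 2` and EVERY temporal extent `L₀ ≥ 1`:

* `ZnThermal.prod_plaquette_time_eq` — the **ladder identity** of an abelian theory: the product of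
  the `L₀` time-like plaquettes above a spatial bond `(y, y + e_i)` is `P_y P_{y+e_i}⁻¹`; hence two
  unequal neighbouring Polyakov loops force a FRUSTRATED (`≠ 1`) time-like plaquette in their ladder
  (`exists_plaquette_ne_one`).
* `ZnThermal.expectation_indicator_frustrated_le` — **Griffiths' bound in the thermal `ℤ_n` theory**:
  the probability that all the time-like plaquettes of a set `T` are frustrated is
  `≤ (n e^{-J_E(1 - cos(2π/n))})^{|T|}`, at every `J_M ≥ 0` (the theory is a Ginibre system,
  `ThermalCentre.expectation_charRep_eq_ginibreExpect`; the bound is the tree's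
  `ginibreExpect_indicator_frustrated_le` with Montvay–Münster's `ℤ_n` action gap `1 - cos(2π/n)`).
* `ZnThermal.expectation_indicator_ne_le` — **Peierls' estimate in a coordinate plane, uniformly in
  the volume**: for `L ≥ 3` and `ρ = 4·19⁶·L₀·n·e^{-J_E(1-cos(2π/n))} < 1`,
  `μ(P_0 ≠ P_x) ≤ 4ρ/(1-ρ)²` for every `x` in the coordinate `(e_0, e_1)`-plane of `(ℤ/L)^d`: on
  `{P_0 ≠ P_x}` the planar Fröhlich–Lieb contour `∂A` of the set `{P_y = P_0}` (tree `sepSet`,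
  `cutKeys`) has all its bonds disagreeing, hence one frustrated plaquette in each of its `|∂A|` ladders
  (`L₀^{|∂A|}` choices), and the tree's volume-uniform contour count `sum_pow_card_cutKeys_le_geom`
  sums `(L₀ n e^{-J_E δ_n})^{|∂A|}`.
* `zn_polyakovCorrelation_ge` — `G_L(x) ≥ 1 - 128·19⁶·L₀·n·e^{-J_E(1-cos(2π/n))}` for all `L ≥ 3`,
  all `J_E, J_M ≥ 0` and all `x` in a coordinate plane (`Re χ(P_0 P̄_x) ≥ 1 - 2·1{P_0 ≠ P_x}`).
* ★ `zn_hasPolyakovLongRangeOrder_of_two_le` — **deconfinement**: for `d ≥ 2`, `n ≥ 2`, every `L₀`,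
  every `J_M ≥ 0` and every `J_E` with `J_E (1 - cos(2π/n)) > log(128·19⁶·L₀·n)`, the Polyakov loops
  have long-range order (`HasPolyakovLongRangeOrder d L₀ (znRep n) J_E J_M`); the threshold is
  LOGARITHMIC in the temporal extent (`zn_finiteTemperatureDeconfinement_of_two_le`:
  `J₀ = (log(128·19⁶·L₀·n) + 1)/(1 - cos(2π/n))`), against the linear `2L₀(d I_d + 1)` of the
  infrared-bound route, and `d = 2` is included.
* Barrier corollaries in every `d ≥ 2` (`zn_not_polyakovConfinementAtAllCouplings_of_two_le`,
  `zn_not_temperatureBlindPolyakovConfinement_of_two_le`, `…UniformClustering…`), and the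
  **two-sided windows in every `d ≥ 2`**: `zn_transition_window_of_even_of_two_le` (no long-range
  order for `J_E < β_c(d)`, tree `zn_criticalBeta_le_of_even_of_hasPolyakovLongRangeOrder`),
  `zn_transition_window_of_odd_of_two_le` (none for `2d(e^{2J_E} - 1) < 1`, tree
  `zn_htRate_ge_one_of_hasPolyakovLongRangeOrder`) — the planar `ℤ_n` entries of the tree's `d ≥ 3`
  windows `zn_transition_window_of_even/odd`.

MECHANISM (Borgs–Seiler §IV p. 358, for abelian groups: the finite-temperature theory is a ferromagnet
of the Polyakov loops with random couplings which "might be expected to create disorder, thereby making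
deconfinement harder. For abelian models this follows from Ginibre's inequalities … This certainly
would be relevant for `d = 2`"): instead of first reducing to the one-layer model we run Peierls'
argument directly in the full theory — Griffiths' bound on frustrated plaquettes holds at every `J_M`.

HONEST LABEL. An abelian, lattice, fixed-`L₀` statement with absurd constants; not located in print as
a separately stated theorem (Borgs–Seiler prove the abelian case for `d ≥ 3` by infrared bounds,
Lemma III.9, and only remark on `d = 2`; the planar discrete-symmetry order is the classical Peierls
mechanism, cf. Friedli–Velenik Remark 10.26). Nothing here bears on `SU(N)`, on the zero-temperature
theory, on `BalabanLadder.IR`, or on the Yang–Mills mass gap (Clay), which is NOT proved; in the `ym`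
ladder only the conditional finite-`𝕋⁴` rung `BalabanLadder.UV` is closed.

## References

* C. Borgs, E. Seiler, Commun. Math. Phys. 91 (1983) 329–380: §II.3 (II.22)–(II.23) p. 337; §III.3
  p. 354 ("gauge groups `U(1)` (or `ℤ_N` …)"), Lemma III.9 p. 356; §IV p. 358 (ultralocal / one-layer
  model, Ginibre's inequalities, the remark on `d = 2`). [BorgsSeiler1983]
* R. Peierls, Proc. Camb. Phil. Soc. 32 (1936) 477–481. [Peierls1936]
* J. Fröhlich, E. H. Lieb, Comm. Math. Phys. 60 (1978) 233–267, §I.C Definition 1, Thm. 1.1, Cor. 1.2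
  (Peierls contours on the torus). [FrohlichLieb1978]
* J. Ginibre, Comm. Math. Phys. 16 (1970) 310–328, §2 Example 4, Model 3 (`ℤ_n` gauge theories as
  generalised rotators). [Ginibre1970]
* I. Montvay, G. Münster, *Quantum Fields on a Lattice* (1994), §3.7.1 item 3 (3.460) (the `ℤ_n` action
  gap `1 - cos(2π/n)`). [MontvayMunster1994]
* S. Friedli, Y. Velenik, *Statistical Mechanics of Lattice Systems* (2017), §3.7.2 and Remark 10.26
  (discrete symmetries order in `d = 2` by Peierls' argument). [FriedliVelenik2017]
-/

noncomputable section

open MeasureTheory Filter Finset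
open scoped Topology ComplexConjugate
open Literature.Probability.LatticeModels Literature.MathematicalPhysics.QuantumLattice
open Literature.Barriers.QuantumFields Literature.Barriers.QuantumFields.FiniteTemperature

namespace Literature.MathematicalPhysics.QuantumFieldTheory

namespace ZnThermal

variable {d L₀ L : ℕ}

/-! ### 1. The ladder identity of an abelian theory -/

section Ladder

variable {G : Type*} [CommGroup G]

/-- **The ladder identity**: in an abelian theory the product of the `L₀` time-like plaquettes above
the spatial bond `(y, y + e_i)` is `P_y · P_{y+e_i}⁻¹` (the space-like links of the ladder cancel in
pairs; the time-like links assemble into the two Polyakov loops, Borgs–Seiler's `g_{L_x}`).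
[cite: BorgsSeiler1983, §II.3 Lemma II.4 and Remark 1 (p. 336)] -/
theorem prod_plaquette_time_eq [NeZero L₀] (U : Config d L₀ L G) (y : Fin d → ZMod L) (i : Fin d) :
    ∏ t : ZMod L₀, plaquette U ((t, y) : FiniteTemperature.Site d L₀ L) none (some i) =
      polyakovLine U y * (polyakovLine U (y + Pi.single i 1))⁻¹ := by
  have hshift : ∀ t : ZMod L₀,
      plaquette U ((t, y) : FiniteTemperature.Site d L₀ L) none (some i) =
        U ((t, y), none) * U ((t + 1, y), some i) * (U ((t, y + Pi.single i 1), none))⁻¹ *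
          (U ((t, y), some i))⁻¹ := fun t => rfl
  simp_rw [hshift, Finset.prod_mul_distrib, Finset.prod_inv_distrib]
  have hre : ∏ t : ZMod L₀, U (((t + 1, y) : FiniteTemperature.Site d L₀ L), some i) =
      ∏ t : ZMod L₀, U (((t, y) : FiniteTemperature.Site d L₀ L), some i) :=
    Fintype.prod_equiv (Equiv.addRight 1) _ _ fun t => by simp only [Equiv.coe_addRight]
  rw [hre, Z2Thermal.polyakovLine_eq_prod, Z2Thermal.polyakovLine_eq_prod,
    mul_right_comm (∏ t : ZMod L₀, U (((t, y) : FiniteTemperature.Site d L₀ L), none)),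
    mul_inv_cancel_right]

/-- **Unequal neighbouring Polyakov loops force a frustrated plaquette in their ladder**: if
`P_y ≠ P_{y+e_i}` then some time-like plaquette `U_P ≠ 1` above the bond `(y, y+e_i)`.
[cite: BorgsSeiler1983, §II.3 Lemma II.4 and Remark 1 (p. 336)] -/
theorem exists_plaquette_ne_one [NeZero L₀] (U : Config d L₀ L G) (y : Fin d → ZMod L) (i : Fin d)
    (h : polyakovLine U y ≠ polyakovLine U (y + Pi.single i 1)) :
    ∃ t : ZMod L₀, plaquette U ((t, y) : FiniteTemperature.Site d L₀ L) none (some i) ≠ 1 := by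
  by_contra hall
  push Not at hall
  have hprod : ∏ t : ZMod L₀, plaquette U ((t, y) : FiniteTemperature.Site d L₀ L) none (some i) = 1 :=
    Finset.prod_eq_one fun t _ => hall t
  rw [prod_plaquette_time_eq] at hprod
  exact h (mul_inv_eq_one.1 hprod)

end Ladder

/-! ### 2. Expectations over a finite gauge group: monotonicity and linearity -/

section FiniteGroup

variable {G : Type*} [Group G] [TopologicalSpace G] [IsTopologicalGroup G] [CompactSpace G]
  [MeasurableSpace G] [BorelSpace G] [SecondCountableTopology G] [Finite G]
  [MeasurableSingletonClass G] {N : ℕ} (ρ : G →* Matrix (Fin N) (Fin N) ℂ)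

/-- Monotonicity of the finite-temperature expectation in the observable (finite gauge group: every
observable is integrable). [cite: BorgsSeiler1983, §II.3 (II.22) (p. 337)] -/
theorem expectation_mono [NeZero L₀] [NeZero L] (hρ : Continuous ρ) (JE JM : ℝ)
    {f g : Config d L₀ L G → ℝ} (h : ∀ U, f U ≤ g U) :
    expectation ρ JE JM f ≤ expectation ρ JE JM g := by
  unfold expectation
  refine div_le_div_of_nonneg_right ?_ (partitionFunction_pos ρ hρ JE JM).le
  exact integral_mono Integrable.of_finite Integrable.of_finite fun U =>
    mul_le_mul_of_nonneg_right (h U) (weight_pos ρ JE JM U).le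

omit [SecondCountableTopology G] in
/-- Linearity: `⟨∑ᵢ cᵢ fᵢ⟩ = ∑ᵢ cᵢ ⟨fᵢ⟩`. [cite: BorgsSeiler1983, §II.3 (II.22) (p. 337)] -/
theorem expectation_sum_mul [NeZero L₀] [NeZero L] (JE JM : ℝ) {κ : Type*} (s : Finset κ)
    (c : κ → ℝ) (f : κ → Config d L₀ L G → ℝ) :
    expectation ρ JE JM (fun U => ∑ k ∈ s, c k * f k U) = ∑ k ∈ s, c k * expectation ρ JE JM (f k) := by
  unfold expectation
  have h : ∫ U, (∑ k ∈ s, c k * f k U) * weight ρ JE JM U ∂haar d L₀ L G =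
      ∑ k ∈ s, c k * ∫ U, f k U * weight ρ JE JM U ∂haar d L₀ L G := by
    have e : ∀ U, (∑ k ∈ s, c k * f k U) * weight ρ JE JM U =
        ∑ k ∈ s, c k * (f k U * weight ρ JE JM U) := fun U => by
      rw [Finset.sum_mul]; exact Finset.sum_congr rfl fun k _ => mul_assoc _ _ _
    simp_rw [e]
    rw [integral_finsetSum _ fun k _ => (Integrable.of_finite).const_mul (c k)]
    exact Finset.sum_congr rfl fun k _ => integral_const_mul _ _
  rw [h, Finset.sum_div]
  exact Finset.sum_congr rfl fun k _ => mul_div_assoc _ _ _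

/-- `⟨c + b f⟩ = c + b ⟨f⟩`. [cite: BorgsSeiler1983, §II.3 (II.22) (p. 337)] -/
theorem expectation_const_add_mul [NeZero L₀] [NeZero L] (hρ : Continuous ρ) (JE JM : ℝ) (c b : ℝ)
    (f : Config d L₀ L G → ℝ) :
    expectation ρ JE JM (fun U => c + b * f U) = c + b * expectation ρ JE JM f := by
  have hZ := partitionFunction_pos (d := d) (L₀ := L₀) (L := L) ρ hρ JE JM
  unfold expectation
  have e : ∀ U : Config d L₀ L G, (c + b * f U) * weight ρ JE JM U =
      c * weight ρ JE JM U + b * (f U * weight ρ JE JM U) := fun U => by ring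
  simp_rw [e]
  rw [integral_add ((Integrable.of_finite).const_mul c) ((Integrable.of_finite).const_mul b),
    integral_const_mul, integral_const_mul]
  field_simp

end FiniteGroup

/-! ### 3. The thermal `ℤ_n` theory as a Ginibre system; Griffiths' bound on frustrated plaquettes -/

section ZnGinibre

variable {n : ℕ}

/-- The plaquette characters of the `ℤ_n` theory take values in the `n`-th roots of unity. [cite: Ginibre1970, §2 Example 4 and Model 3 (ℤ_n gauge theories)] -/
theorem plaqChars_pow_eq_one (a : Z2Thermal.PlaqIdx d L₀ L) (σ : Config d L₀ L ↥(rootsOfUnityCircle n)) :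
    (ThermalCentre.plaqChars d L₀ L (znIncl n) a σ) ^ n = 1 := by
  change ((znIncl n) (plaquette σ _ _ _)) ^ n = 1
  rw [znIncl_apply]
  exact mem_rootsOfUnityCircle.1 (plaquette σ _ _ _).2

/-- An `n`-th root of unity `≠ 1` has real part `≤ cos(2π/n) = 1 - (1 - cos(2π/n))` (Montvay–Münster's
action gap of `ℤ_n`, (3.460)). [cite: MontvayMunster1994, §3.7.1 item 3 eq. (3.460) (PDF p. 164)] -/
theorem re_le_of_ne_one (hn : 2 ≤ n) {γ : ↥(rootsOfUnityCircle n)} (hγ : (γ : Circle) ≠ 1) :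
    (((γ : Circle)) : ℂ).re ≤ 1 - znActionGap n := by
  haveI : NeZero n := ⟨by omega⟩
  rw [znActionGap, sub_sub_cancel]
  obtain ⟨k, hk, hzk⟩ := exists_eq_exp_of_mem γ
  rw [hzk, re_exp_two_pi_mul_I]
  have hk0 : 0 < k := by
    rcases Nat.eq_zero_or_pos k with h0 | h0
    · exfalso
      subst h0
      apply hγ
      apply Circle.ext
      rw [hzk]
      simp
    · exact h0
  exact cos_two_pi_mul_div_le hn hk0 hk

/-- The action gap of the `ℤ_n` plaquette characters: `Re χ_P(σ) ≤ 1 - (1 - cos(2π/n))` off `χ_P(σ) = 1`. [cite: MontvayMunster1994, §3.7.1 item 3 eq. (3.460) (PDF p. 164)] -/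
theorem re_plaqChars_le_of_ne_one (hn : 2 ≤ n) (a : Z2Thermal.PlaqIdx d L₀ L)
    (σ : Config d L₀ L ↥(rootsOfUnityCircle n)) (h : ThermalCentre.plaqChars d L₀ L (znIncl n) a σ ≠ 1) :
    ((ThermalCentre.plaqChars d L₀ L (znIncl n) a σ : Circle) : ℂ).re ≤ 1 - znActionGap n := by
  change (((znIncl n) (plaquette σ _ _ _) : Circle) : ℂ).re ≤ _
  rw [znIncl_apply]
  exact re_le_of_ne_one hn (by rwa [← znIncl_apply])

/-- The couplings `(J_E, J_M)` are ferromagnetic for `J_E, J_M ≥ 0`. [cite: BorgsSeiler1983, §II.3 (II.20) (pp. 335–336)] -/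
private theorem cpl_nonneg {JE JM : ℝ} (hJE : 0 ≤ JE) (hJM : 0 ≤ JM) (a : Z2Thermal.PlaqIdx d L₀ L) :
    0 ≤ Z2Thermal.cpl JE JM a := by
  rcases a with a | a <;> simp [Z2Thermal.cpl, hJE, hJM]

variable [NeZero L₀] [NeZero L]

/-- **Every expectation of the thermal `ℤ_n` theory is a Ginibre expectation** (plaquette characters,
couplings `(J_E, J_M)`). [cite: Ginibre1970, §2 Example 4 and Model 3 (ℤ_n gauge theories)] -/
theorem expectation_znRep_eq_ginibreExpect (JE JM : ℝ) (f : Config d L₀ L ↥(rootsOfUnityCircle n) → ℝ) :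
    expectation (znRep n) JE JM f =
      ginibreExpect (haar d L₀ L ↥(rootsOfUnityCircle n)) (ThermalCentre.plaqChars d L₀ L (znIncl n))
        (Z2Thermal.cpl JE JM) f := by
  rw [← charRep_znIncl]
  exact ThermalCentre.expectation_charRep_eq_ginibreExpect _ _ _ _

/-- ★ **Griffiths' bound on frustrated time-like plaquettes in the thermal `ℤ_n` theory** (`n ≥ 2`):
for `J_E, J_M ≥ 0` and every finite set `T` of time-like plaquettes `(x; time, i)`,
`μ(U_P ≠ 1 ∀ P ∈ T) ≤ (n e^{-J_E (1 - cos(2π/n))})^{|T|}` — in every periodic box, at every temporal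
extent and every magnetic coupling (the tree's `ginibreExpect_indicator_frustrated_le` for the Ginibre
system of the `ℤ_n` theory). [cite: Ginibre1970, Prop. 3 with §2 Example 4 and Model 3 (Griffiths' inequalities for ℤ_n gauge theories)] [cite: BorgsSeiler1983, §IV (p. 358)] -/
theorem expectation_indicator_frustrated_le (hn : 2 ≤ n) {JE JM : ℝ} (hJE : 0 ≤ JE) (hJM : 0 ≤ JM)
    (T : Finset (FiniteTemperature.Site d L₀ L × Fin d)) :
    expectation (znRep n) JE JM
        ({U : Config d L₀ L ↥(rootsOfUnityCircle n) | ∀ q ∈ T, plaquette U q.1 none (some q.2) ≠ 1}.indicator 1) ≤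
      ((n : ℝ) * Real.exp (-(JE * znActionGap n))) ^ T.card := by
  haveI : NeZero n := ⟨by omega⟩
  haveI : (haar d L₀ L ↥(rootsOfUnityCircle n)).IsHaarMeasure := by unfold haar; infer_instance
  set S : Finset (Z2Thermal.PlaqIdx d L₀ L) := T.map ⟨Sum.inl, Sum.inl_injective⟩ with hS
  have hset : {U : Config d L₀ L ↥(rootsOfUnityCircle n) | ∀ q ∈ T, plaquette U q.1 none (some q.2) ≠ 1} =
      {U | ∀ a ∈ S, ThermalCentre.plaqChars d L₀ L (znIncl n) a U ≠ 1} := by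
    ext U
    simp only [Set.mem_setOf_eq, hS, Finset.mem_map, Function.Embedding.coeFn_mk, forall_exists_index,
      and_imp, forall_apply_eq_imp_iff₂]
    refine forall_congr' fun q => imp_congr_right fun _ => ?_
    change _ ↔ (znIncl n) (plaquette U q.1 none (some q.2)) ≠ 1
    rw [znIncl_apply, ne_eq, ne_eq, OneMemClass.coe_eq_one]
  rw [hset, expectation_znRep_eq_ginibreExpect]
  refine (ginibreExpect_indicator_frustrated_le (haar d L₀ L ↥(rootsOfUnityCircle n))
    (ThermalCentre.plaqChars d L₀ L (znIncl n)) (cpl_nonneg hJE hJM) S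
    (fun a _ σ => plaqChars_pow_eq_one a σ)
    (fun a _ σ h => re_plaqChars_le_of_ne_one hn a σ h)).trans (le_of_eq ?_)
  rw [hS, Finset.prod_map]
  simp only [Function.Embedding.coeFn_mk]
  have hc : ∀ x ∈ T, (n : ℝ) * Real.exp (-(Z2Thermal.cpl JE JM (Sum.inl x : Z2Thermal.PlaqIdx d L₀ L) *
      znActionGap n)) = (n : ℝ) * Real.exp (-(JE * znActionGap n)) := fun _ _ => rfl
  rw [Finset.prod_congr rfl hc, Finset.prod_const]

end ZnGinibre

/-! ### 4. Peierls' argument in a coordinate plane of `(ℤ/L)^d` -/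

section Plane

/-- The coordinate `(e_0, e_1)`-plane of the spatial torus `(ℤ/L)^d`, `d ≥ 2`, parametrised by the
planar torus `(ℤ/L)²`. [cite: FrohlichLieb1978, §I.C Definition 1] -/
def planeEmb (d' : ℕ) (p : TorusSite 2 L) : Fin d' → ZMod L :=
  fun j => if hj : (j : ℕ) < 2 then p ⟨j, hj⟩ else 0

/-- `planeEmb 0 = 0`. [folklore] -/
private theorem planeEmb_zero : planeEmb d (L := L) 0 = 0 := by
  funext j; simp [planeEmb]

/-- The plane embedding is injective. [folklore] -/
private theorem planeEmb_injective (hd : 2 ≤ d) : Function.Injective (planeEmb d (L := L)) := by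
  intro p p' h
  funext k
  have := congrFun h (Fin.castLE hd k)
  simpa [planeEmb, Fin.val_castLE, k.2] using this

/-- A planar nearest-neighbour step is a spatial nearest-neighbour step:
`ι(p + e_k) = ι(p) + e_{ι k}`. [folklore] -/
private theorem planeEmb_add_single (hd : 2 ≤ d) (p : TorusSite 2 L) (k : Fin 2) :
    planeEmb d (p + Pi.single k (1 : ZMod L)) =
      planeEmb d p + (Pi.single (Fin.castLE hd k) (1 : ZMod L) : Fin d → ZMod L) := by
  funext j
  by_cases hj : (j : ℕ) < 2
  · have hL : planeEmb d (p + Pi.single k (1 : ZMod L)) j =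
        p ⟨j, hj⟩ + (Pi.single k (1 : ZMod L) : TorusSite 2 L) ⟨j, hj⟩ := by
      simp only [planeEmb, dif_pos hj, Pi.add_apply]
    have hR : (planeEmb d p + (Pi.single (Fin.castLE hd k) (1 : ZMod L) : Fin d → ZMod L)) j =
        p ⟨j, hj⟩ + (Pi.single (Fin.castLE hd k) (1 : ZMod L) : Fin d → ZMod L) j := by
      simp only [planeEmb, dif_pos hj, Pi.add_apply]
    rw [hL, hR]
    congr 1
    by_cases hjk : (⟨j, hj⟩ : Fin 2) = k
    · have : j = Fin.castLE hd k := by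
        apply Fin.ext; rw [Fin.val_castLE, ← hjk]
      rw [hjk, this, Pi.single_eq_same, Pi.single_eq_same]
    · have : j ≠ Fin.castLE hd k := by
        intro h; apply hjk; apply Fin.ext; simp [h]
      rw [Pi.single_eq_of_ne hjk, Pi.single_eq_of_ne this]
  · have hL : planeEmb d (p + Pi.single k (1 : ZMod L)) j = 0 := by simp only [planeEmb, dif_neg hj]
    have hR : (planeEmb d p + (Pi.single (Fin.castLE hd k) (1 : ZMod L) : Fin d → ZMod L)) j =
        0 + (Pi.single (Fin.castLE hd k) (1 : ZMod L) : Fin d → ZMod L) j := by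
      simp only [planeEmb, dif_neg hj, Pi.add_apply]
    have : j ≠ Fin.castLE hd k := by
      intro h; apply hj; rw [h, Fin.val_castLE]; exact k.2
    rw [hL, hR, Pi.single_eq_of_ne this, add_zero]

/-- The axis point `m e_0` of `ℤ^d` read in the periodic box is the image of the planar point `m e_0`.
[folklore] -/
private theorem planeEmb_single_zero (hd : 2 ≤ d) (m : ℤ) :
    (fun i => ((Pi.single (Fin.castLE hd 0) m : Fin d → ℤ) i : ZMod L)) =
      planeEmb d (Pi.single (0 : Fin 2) (m : ZMod L) : TorusSite 2 L) := by
  funext j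
  by_cases hj : (j : ℕ) < 2
  · have hR : planeEmb d (Pi.single (0 : Fin 2) (m : ZMod L) : TorusSite 2 L) j =
        (Pi.single (0 : Fin 2) (m : ZMod L) : TorusSite 2 L) ⟨j, hj⟩ := by simp only [planeEmb, dif_pos hj]
    rw [hR]
    by_cases h0 : (⟨j, hj⟩ : Fin 2) = 0
    · have : j = Fin.castLE hd 0 := by apply Fin.ext; rw [Fin.val_castLE, ← h0]
      rw [h0, this, Pi.single_eq_same, Pi.single_eq_same]
    · have : j ≠ Fin.castLE hd 0 := by
        intro h; apply h0; apply Fin.ext; simp [h]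
      rw [Pi.single_eq_of_ne this, Pi.single_eq_of_ne h0, Int.cast_zero]
  · have hR : planeEmb d (Pi.single (0 : Fin 2) (m : ZMod L) : TorusSite 2 L) j = 0 := by
      simp only [planeEmb, dif_neg hj]
    have : j ≠ Fin.castLE hd 0 := by
      intro h; apply hj; rw [h, Fin.val_castLE]; exact Nat.zero_lt_two
    rw [hR, Pi.single_eq_of_ne this, Int.cast_zero]

/-- Pointwise union bound for indicators over a `Finset`-indexed union. [folklore] -/
private theorem indicator_biUnion_le_sum {α κ : Type*} (s : Finset κ) (E : κ → Set α) (x : α) :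
    (⋃ k ∈ s, E k).indicator (1 : α → ℝ) x ≤ ∑ k ∈ s, (E k).indicator 1 x := by
  classical
  by_cases hx : x ∈ ⋃ k ∈ s, E k
  · rw [Set.indicator_of_mem hx, Pi.one_apply]
    obtain ⟨k, hk, hxk⟩ := Set.mem_iUnion₂.1 hx
    refine le_trans (le_of_eq (Set.indicator_of_mem hxk (1 : α → ℝ)).symm) ?_
    exact Finset.single_le_sum (f := fun k => (E k).indicator (1 : α → ℝ) x)
      (fun k _ => Set.indicator_nonneg (fun _ _ => zero_le_one) x) hk
  · rw [Set.indicator_of_notMem hx]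
    exact Finset.sum_nonneg fun k _ => Set.indicator_nonneg (fun _ _ => zero_le_one) x

/-- Pointwise union bound for indicators over a finite type. [folklore] -/
private theorem indicator_iUnion_le_sum {α κ : Type*} [Fintype κ] (E : κ → Set α) (x : α) :
    (⋃ k, E k).indicator (1 : α → ℝ) x ≤ ∑ k, (E k).indicator 1 x := by
  have h := indicator_biUnion_le_sum (Finset.univ : Finset κ) E x
  simpa using h

/-- Monotonicity of indicators in the set. [folklore] -/
private theorem indicator_le_indicator_of_subset' {α : Type*} {E F : Set α} (h : E ⊆ F) (x : α) :
    E.indicator (1 : α → ℝ) x ≤ F.indicator 1 x :=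
  Set.indicator_le_indicator_of_subset h (fun _ => zero_le_one) x

variable {n : ℕ} [NeZero L]

/-- The event "all the bonds of the planar contour `∂A` disagree": `P_{ι i} ≠ P_{ι(i + e_k)}` for every
cut key `(i, k)` of `A` (Fröhlich–Lieb's contour condition for the Polyakov-loop colouring).
[cite: FrohlichLieb1978, §I.C Definition 1 and (1.30)] -/
def disagreeSet (A : Finset (TorusSite 2 L)) : Set (Config d L₀ L ↥(rootsOfUnityCircle n)) :=
  {U | ∀ e ∈ cutKeys L A,
    polyakovLine U (planeEmb d e.1) ≠ polyakovLine U (planeEmb d (e.1 + Pi.single e.2 (1 : ZMod L)))}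

/-- The event "one prescribed time-like plaquette is frustrated in each ladder of the contour": for a
choice `τ` of time slices over the cut keys of `A`. [cite: BorgsSeiler1983, §IV (p. 358)] -/
def ladderSet (hd : 2 ≤ d) (A : Finset (TorusSite 2 L)) (τ : ↥(cutKeys L A) → ZMod L₀) : Set (Config d L₀ L ↥(rootsOfUnityCircle n)) :=
  {U | ∀ e : ↥(cutKeys L A),
    plaquette U ((τ e, planeEmb d e.1.1) : FiniteTemperature.Site d L₀ L) none (some (Fin.castLE hd e.1.2)) ≠ 1}

/-- The set of prescribed time-like plaquettes `((τ e, ι i), ι k)` of a choice `τ` over the cut keys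
`e = (i, k)`. [folklore] -/
def ladderPlaqs (hd : 2 ≤ d) (A : Finset (TorusSite 2 L)) (τ : ↥(cutKeys L A) → ZMod L₀) :
    Finset (FiniteTemperature.Site d L₀ L × Fin d) :=
  Finset.univ.image fun e : ↥(cutKeys L A) =>
    (((τ e, planeEmb d e.1.1) : FiniteTemperature.Site d L₀ L), Fin.castLE hd e.1.2)

/-- The prescribed plaquettes are `|∂A|` many (distinct keys give distinct plaquettes). [folklore] -/
private theorem card_ladderPlaqs (hd : 2 ≤ d) (A : Finset (TorusSite 2 L)) (τ : ↥(cutKeys L A) → ZMod L₀) :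
    (ladderPlaqs (d := d) hd A τ).card = (cutKeys L A).card := by
  rw [ladderPlaqs, Finset.card_image_of_injective, Finset.card_univ, Fintype.card_coe]
  intro e e' h
  simp only [Prod.mk.injEq] at h
  obtain ⟨⟨-, h1⟩, h2⟩ := h
  apply Subtype.ext
  exact Prod.ext (planeEmb_injective hd h1) (Fin.castLE_injective hd h2)

/-- `ladderSet ⊆ {all plaquettes of ladderPlaqs frustrated}`. [folklore] -/
private theorem ladderSet_subset (hd : 2 ≤ d) (A : Finset (TorusSite 2 L)) (τ : ↥(cutKeys L A) → ZMod L₀) :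
    ladderSet (n := n) hd A τ ⊆
      {U : Config d L₀ L ↥(rootsOfUnityCircle n) | ∀ q ∈ ladderPlaqs hd A τ, plaquette U q.1 none (some q.2) ≠ 1} := by
  intro U hU q hq
  simp only [ladderPlaqs, Finset.mem_image, Finset.mem_univ, true_and] at hq
  obtain ⟨e, rfl⟩ := hq
  exact hU e

variable [NeZero L₀]

/-- **The disagreement event lies in the union of the ladder events**: on `disagreeSet A` every cut key
has a frustrated plaquette in its ladder (`exists_plaquette_ne_one`), i.e. some choice `τ` works.
[cite: BorgsSeiler1983, §IV (p. 358)] -/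
private theorem disagreeSet_subset_iUnion (hd : 2 ≤ d) (A : Finset (TorusSite 2 L)) :
    disagreeSet (d := d) (n := n) (L₀ := L₀) A ⊆ ⋃ τ : ↥(cutKeys L A) → ZMod L₀, ladderSet hd A τ := by
  intro U hU
  have hex : ∀ e : ↥(cutKeys L A), ∃ t : ZMod L₀,
      plaquette U ((t, planeEmb d e.1.1) : FiniteTemperature.Site d L₀ L) none
        (some (Fin.castLE hd e.1.2)) ≠ 1 := by
    intro e
    have h := hU e.1 e.2
    rw [planeEmb_add_single hd] at h
    exact exists_plaquette_ne_one U _ _ h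
  choose τ hτ using hex
  exact Set.mem_iUnion.2 ⟨τ, fun e => hτ e⟩

/-- **The probability that a planar contour has all its bonds disagreeing** is at most
`(L₀ · n e^{-J_E(1-cos(2π/n))})^{|∂A|}`: a union over the `L₀^{|∂A|}` ladder choices of Griffiths' bound
`expectation_indicator_frustrated_le`. [cite: BorgsSeiler1983, §IV (p. 358)] [cite: FriedliVelenik2017, §3.7.2 eq. (3.37)] -/
theorem expectation_indicator_disagreeSet_le (hn : 2 ≤ n) (hd : 2 ≤ d) {JE JM : ℝ} (hJE : 0 ≤ JE)
    (hJM : 0 ≤ JM) (A : Finset (TorusSite 2 L)) :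
    expectation (znRep n) JE JM ((disagreeSet (d := d) (n := n) (L₀ := L₀) A).indicator 1) ≤
      ((L₀ : ℝ) * ((n : ℝ) * Real.exp (-(JE * znActionGap n)))) ^ (cutKeys L A).card := by
  haveI : NeZero n := ⟨by omega⟩
  set ε : ℝ := (n : ℝ) * Real.exp (-(JE * znActionGap n)) with hε
  have hρc := continuous_znRep n
  -- union bound over the ladder choices
  have h1 : expectation (znRep n) JE JM ((disagreeSet (d := d) (n := n) (L₀ := L₀) A).indicator 1) ≤
      expectation (znRep n) JE JM (fun U => ∑ τ : ↥(cutKeys L A) → ZMod L₀,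
        (1 : ℝ) * (ladderSet (n := n) hd A τ).indicator 1 U) := by
    refine expectation_mono (znRep n) hρc JE JM fun U => ?_
    refine (indicator_le_indicator_of_subset' (disagreeSet_subset_iUnion hd A) U).trans ?_
    simpa only [one_mul] using indicator_iUnion_le_sum (fun τ => ladderSet (n := n) hd A τ) U
  have h2 : ∀ τ : ↥(cutKeys L A) → ZMod L₀,
      expectation (znRep n) JE JM ((ladderSet (n := n) hd A τ).indicator 1) ≤ ε ^ (cutKeys L A).card := by
    intro τ
    refine (expectation_mono (znRep n) hρc JE JM (indicator_le_indicator_of_subset'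
      (ladderSet_subset hd A τ))).trans ?_
    rw [← card_ladderPlaqs (d := d) hd A τ]
    exact expectation_indicator_frustrated_le hn hJE hJM _
  rw [expectation_sum_mul] at h1
  refine h1.trans ?_
  calc ∑ τ : ↥(cutKeys L A) → ZMod L₀, 1 * expectation (znRep n) JE JM ((ladderSet (n := n) hd A τ).indicator 1)
      ≤ ∑ _τ : ↥(cutKeys L A) → ZMod L₀, ε ^ (cutKeys L A).card :=
        Finset.sum_le_sum fun τ _ => by rw [one_mul]; exact h2 τ
    _ = ((L₀ : ℝ) * ε) ^ (cutKeys L A).card := by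
        rw [Finset.sum_const, Finset.card_univ, Fintype.card_fun, ZMod.card, Fintype.card_coe,
          nsmul_eq_mul, mul_pow]
        push_cast
        ring

omit [NeZero L₀] in
open Classical in
/-- **The contour of a configuration** (Fröhlich–Lieb's Definition 1 for the Polyakov-loop colouring
`y ↦ [P_{ι y} = P_{ι m}]`): on `{P_{ι m} ≠ P_{ι q}}` the separating set `A` of the cluster of `m` has all
its boundary bonds disagreeing, so `{P_{ι m} ≠ P_{ι q}} ⊆ ⋃_{A separating} disagreeSet A` (`L ≥ 2`).
[cite: FrohlichLieb1978, §I.C Definition 1 and (1.30)] -/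
theorem ne_subset_iUnion_disagreeSet (hL : 1 < L) (m q : TorusSite 2 L) :
    {U : Config d L₀ L ↥(rootsOfUnityCircle n) | polyakovLine U (planeEmb d m) ≠ polyakovLine U (planeEmb d q)} ⊆
      ⋃ A ∈ (Finset.univ.filter fun A => IsSeparatingSet L A m q), disagreeSet (d := d) (n := n) (L₀ := L₀) A := by
  intro U hU
  set c : TorusSite 2 L → Bool := fun y => decide (polyakovLine U (planeEmb d y) = polyakovLine U (planeEmb d m))
    with hc
  have hcm : c m = true := by simp [hc]
  have hcq : c q = false := by
    simp only [hc, decide_eq_false_iff_not]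
    exact fun h => hU h.symm
  refine Set.mem_iUnion₂.2 ⟨sepSet c m q, Finset.mem_filter.2 ⟨Finset.mem_univ _, isSeparatingSet_sepSet hL hcm hcq⟩, ?_⟩
  intro e he
  have hcut := mem_cutKeys.1 he
  have hadj : (torusGraph 2 L).Adj e.1 (e.1 + Pi.single e.2 (1 : ZMod L)) := torusGraph_adj_add_single (by omega) _ _
  by_cases h1 : e.1 ∈ sepSet c m q
  · have h2 : e.1 + Pi.single e.2 1 ∉ sepSet c m q := fun h => hcut ⟨fun _ => h, fun _ => h1⟩
    obtain ⟨hu, hv⟩ := sepSet_compatible hcm hcq h1 h2 hadj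
    have hu' : polyakovLine U (planeEmb d e.1) = polyakovLine U (planeEmb d m) := by simpa [hc] using hu
    have hv' : polyakovLine U (planeEmb d (e.1 + Pi.single e.2 1)) ≠ polyakovLine U (planeEmb d m) := by
      simpa [hc] using hv
    exact fun h => hv' (h ▸ hu')
  · have h2 : e.1 + Pi.single e.2 1 ∈ sepSet c m q := by
      by_contra h; exact hcut ⟨fun h' => absurd h' h1, fun h' => absurd h' h⟩
    obtain ⟨hu, hv⟩ := sepSet_compatible hcm hcq h2 h1 hadj.symm
    have hu' : polyakovLine U (planeEmb d (e.1 + Pi.single e.2 1)) = polyakovLine U (planeEmb d m) := by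
      simpa [hc] using hu
    have hv' : polyakovLine U (planeEmb d e.1) ≠ polyakovLine U (planeEmb d m) := by simpa [hc] using hv
    exact fun h => hv' (h.symm ▸ hu')

/-- ★ **Peierls' estimate for the Polyakov loops of the thermal `ℤ_n` theory in a coordinate plane,
uniformly in the volume**: for `n ≥ 2`, `d ≥ 2`, `L ≥ 3`, `J_E, J_M ≥ 0` and
`ρ = 4·19⁶·L₀·n·e^{-J_E(1-cos(2π/n))} < 1`,
`μ_{L₀,L;J_E,J_M}(P_{ι m} ≠ P_{ι q}) ≤ Σ_{A separating} (L₀ n e^{-J_E δ_n})^{|∂A|} ≤ 4ρ/(1-ρ)²` — union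
bound over the contour of the configuration, Griffiths' bound for each contour, and Fröhlich–Lieb's
volume-uniform torus contour count (tree `sum_pow_card_cutKeys_le_geom`).
[cite: FrohlichLieb1978, Thm. 1.1 and Cor. 1.2, eqs. (1.30)–(1.33)] [cite: BorgsSeiler1983, §IV (p. 358)] -/
theorem expectation_indicator_ne_le (hn : 2 ≤ n) (hd : 2 ≤ d) (hL : 2 < L) {JE JM : ℝ} (hJE : 0 ≤ JE)
    (hJM : 0 ≤ JM) (hρ : 4 * 19 ^ 6 * ((L₀ : ℝ) * ((n : ℝ) * Real.exp (-(JE * znActionGap n)))) < 1)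
    (m q : TorusSite 2 L) :
    expectation (znRep n) JE JM
        ({U : Config d L₀ L ↥(rootsOfUnityCircle n) | polyakovLine U (planeEmb d m) ≠ polyakovLine U (planeEmb d q)}.indicator 1) ≤
      4 * (4 * 19 ^ 6 * ((L₀ : ℝ) * ((n : ℝ) * Real.exp (-(JE * znActionGap n))))) /
        (1 - 4 * 19 ^ 6 * ((L₀ : ℝ) * ((n : ℝ) * Real.exp (-(JE * znActionGap n))))) ^ 2 := by
  classical
  haveI : NeZero n := ⟨by omega⟩
  set θ : ℝ := (L₀ : ℝ) * ((n : ℝ) * Real.exp (-(JE * znActionGap n))) with hθ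
  have hθ0 : 0 ≤ θ := by positivity
  have hL1 : 1 < L := by omega
  set 𝒜 : Finset (Finset (TorusSite 2 L)) := Finset.univ.filter fun A => IsSeparatingSet L A m q with h𝒜
  have hρc := continuous_znRep n
  calc expectation (znRep n) JE JM
        ({U : Config d L₀ L ↥(rootsOfUnityCircle n) | polyakovLine U (planeEmb d m) ≠ polyakovLine U (planeEmb d q)}.indicator 1)
      ≤ expectation (znRep n) JE JM (fun U => ∑ A ∈ 𝒜,
          (1 : ℝ) * (disagreeSet (d := d) (n := n) (L₀ := L₀) A).indicator 1 U) := by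
        refine expectation_mono (znRep n) hρc JE JM fun U => ?_
        refine (indicator_le_indicator_of_subset' (ne_subset_iUnion_disagreeSet hL1 m q) U).trans ?_
        simpa only [one_mul] using
          indicator_biUnion_le_sum 𝒜 (fun A => disagreeSet (d := d) (n := n) (L₀ := L₀) A) U
    _ = ∑ A ∈ 𝒜, 1 * expectation (znRep n) JE JM ((disagreeSet (d := d) (n := n) (L₀ := L₀) A).indicator 1) :=
        expectation_sum_mul _ _ _ _ _ _
    _ ≤ ∑ A ∈ 𝒜, θ ^ (cutKeys L A).card :=
        Finset.sum_le_sum fun A _ => by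
          rw [one_mul]; exact expectation_indicator_disagreeSet_le hn hd hJE hJM A
    _ ≤ 4 * (4 * 19 ^ 6 * θ) / (1 - 4 * 19 ^ 6 * θ) ^ 2 :=
        sum_pow_card_cutKeys_le_geom hL1 m q 𝒜 (fun A hA => (Finset.mem_filter.1 hA).2) hθ0 hρ

end Plane

/-! ### 5. The Polyakov correlation in a coordinate plane -/

section Correlation

variable {n : ℕ} [NeZero L₀] [NeZero L]

omit [NeZero L₀] [NeZero L] in
/-- For the one-dimensional character of `ℤ_n`: `Re χ(P_0) χ̄(P_x) ≥ 1 - 2·1{P_0 ≠ P_x}` (`= 1` if the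
loops agree, `≥ -1` always). [cite: BorgsSeiler1983, §II.3 (II.22) (p. 337)] -/
theorem polyakovIntegrand_ge (U : Config d L₀ L ↥(rootsOfUnityCircle n)) (x : Fin d → ZMod L) :
    1 - 2 * {U : Config d L₀ L ↥(rootsOfUnityCircle n) | polyakovLine U 0 ≠ polyakovLine U x}.indicator 1 U ≤
      (polyakovTrace (znRep n) U 0 * conj (polyakovTrace (znRep n) U x)).re := by
  rw [← charRep_znIncl, ← ThermalCentre.reChar_pairChar]
  by_cases h : polyakovLine U 0 = polyakovLine U x
  · have hmem : U ∉ {U : Config d L₀ L ↥(rootsOfUnityCircle n) | polyakovLine U 0 ≠ polyakovLine U x} :=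
      fun h' => h' h
    rw [Set.indicator_of_notMem hmem, mul_zero, sub_zero]
    have : ThermalCentre.pairChar (L₀ := L₀) (znIncl n) x U = 1 := by
      rw [ThermalCentre.pairChar]
      change ThermalCentre.lineChar (znIncl n) 0 U * (ThermalCentre.lineChar (znIncl n) x U)⁻¹ = 1
      rw [ThermalCentre.lineChar_apply, ThermalCentre.lineChar_apply, h, mul_inv_cancel]
    rw [reChar, this, Circle.coe_one, Complex.one_re]
  · have hmem : U ∈ {U : Config d L₀ L ↥(rootsOfUnityCircle n) | polyakovLine U 0 ≠ polyakovLine U x} := h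
    rw [Set.indicator_of_mem hmem, Pi.one_apply, mul_one]
    have := abs_reChar_le_one (ThermalCentre.pairChar (L₀ := L₀) (znIncl n) x) U
    have := neg_abs_le (reChar (ThermalCentre.pairChar (L₀ := L₀) (znIncl n) x) U)
    linarith

/-- **Lower bound for the planar Polyakov correlation of the thermal `ℤ_n` theory, contour-series
form**: for `n ≥ 2`, `d ≥ 2`, `L ≥ 3`, `J_E, J_M ≥ 0` and `ρ = 4·19⁶·L₀·n·e^{-J_E(1-cos(2π/n))} < 1`,
`G_L(ι q) ≥ 1 - 8ρ/(1-ρ)²` for every planar `q`. [cite: FrohlichLieb1978, Thm. 1.1 and Cor. 1.2] [cite: BorgsSeiler1983, §IV (p. 358)] -/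
theorem polyakovCorrelation_planeEmb_ge (hn : 2 ≤ n) (hd : 2 ≤ d) (hL : 2 < L) {JE JM : ℝ}
    (hJE : 0 ≤ JE) (hJM : 0 ≤ JM)
    (hρ : 4 * 19 ^ 6 * ((L₀ : ℝ) * ((n : ℝ) * Real.exp (-(JE * znActionGap n)))) < 1) (q : TorusSite 2 L) :
    1 - 8 * (4 * 19 ^ 6 * ((L₀ : ℝ) * ((n : ℝ) * Real.exp (-(JE * znActionGap n))))) /
        (1 - 4 * 19 ^ 6 * ((L₀ : ℝ) * ((n : ℝ) * Real.exp (-(JE * znActionGap n))))) ^ 2 ≤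
      polyakovCorrelation (L₀ := L₀) (znRep n) JE JM (planeEmb d q) := by
  haveI : NeZero n := ⟨by omega⟩
  set B : ℝ := 4 * (4 * 19 ^ 6 * ((L₀ : ℝ) * ((n : ℝ) * Real.exp (-(JE * znActionGap n))))) /
    (1 - 4 * 19 ^ 6 * ((L₀ : ℝ) * ((n : ℝ) * Real.exp (-(JE * znActionGap n))))) ^ 2 with hB
  have hρc := continuous_znRep n
  have h1 : expectation (znRep n) JE JM
      ({U : Config d L₀ L ↥(rootsOfUnityCircle n) | polyakovLine U 0 ≠ polyakovLine U (planeEmb d q)}.indicator 1) ≤ B := by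
    have h := expectation_indicator_ne_le (n := n) (L₀ := L₀) hn hd hL hJE hJM hρ 0 q
    rwa [planeEmb_zero] at h
  have h2 : 1 - 2 * B ≤ expectation (znRep n) JE JM (fun U => 1 + (-2) *
      {U : Config d L₀ L ↥(rootsOfUnityCircle n) | polyakovLine U 0 ≠ polyakovLine U (planeEmb d q)}.indicator 1 U) := by
    rw [expectation_const_add_mul (znRep n) hρc]
    linarith
  have hptw : ∀ U : Config d L₀ L ↥(rootsOfUnityCircle n), 1 + (-2) *
      {U : Config d L₀ L ↥(rootsOfUnityCircle n) | polyakovLine U 0 ≠ polyakovLine U (planeEmb d q)}.indicator 1 U ≤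
        (polyakovTrace (znRep n) U 0 * conj (polyakovTrace (znRep n) U (planeEmb d q))).re := by
    intro U
    have := polyakovIntegrand_ge (n := n) U (planeEmb d q)
    linarith
  have h3 := expectation_mono (znRep n) hρc JE JM hptw
  have h4 : 8 * (4 * 19 ^ 6 * ((L₀ : ℝ) * ((n : ℝ) * Real.exp (-(JE * znActionGap n))))) /
      (1 - 4 * 19 ^ 6 * ((L₀ : ℝ) * ((n : ℝ) * Real.exp (-(JE * znActionGap n))))) ^ 2 = 2 * B := by
    rw [hB]; ring
  rw [h4, polyakovCorrelation]
  exact h2.trans h3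

/-- ★ **Volume-uniform lower bound for the planar Polyakov correlation of the thermal `ℤ_n` theory**:
for `n ≥ 2`, `d ≥ 2`, every `L ≥ 3`, every `L₀ ≥ 1`, all `J_E, J_M ≥ 0` and every `q` in the coordinate
plane, `G_L(ι q) ≥ 1 - 128·19⁶·L₀·n·e^{-J_E(1 - cos(2π/n))}` (for `ρ ≤ 1/2`: `8ρ/(1-ρ)² ≤ 32ρ`;
otherwise the bound is below `-1 ≤ G_L`). [cite: FrohlichLieb1978, Thm. 1.1 and Cor. 1.2] [cite: BorgsSeiler1983, §IV (p. 358)] [cite: Peierls1936] -/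
theorem _root_.Literature.MathematicalPhysics.QuantumFieldTheory.zn_polyakovCorrelation_ge (hn : 2 ≤ n)
    (hd : 2 ≤ d) (hL : 3 ≤ L) {JE JM : ℝ} (hJE : 0 ≤ JE) (hJM : 0 ≤ JM) (q : TorusSite 2 L) :
    1 - 128 * 19 ^ 6 * ((L₀ : ℝ) * ((n : ℝ) * Real.exp (-(JE * znActionGap n)))) ≤
      polyakovCorrelation (L₀ := L₀) (znRep n) JE JM (planeEmb d q) := by
  set θ : ℝ := (L₀ : ℝ) * ((n : ℝ) * Real.exp (-(JE * znActionGap n))) with hθ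
  have hθ0 : 0 ≤ θ := by positivity
  by_cases hsmall : 8 * 19 ^ 6 * θ ≤ 1
  · set ρ : ℝ := 4 * 19 ^ 6 * θ with hρ
    have hρ0 : 0 ≤ ρ := by positivity
    have hρhalf : ρ ≤ 1 / 2 := by rw [hρ]; linarith
    have hρ1 : ρ < 1 := by linarith
    have hmain := polyakovCorrelation_planeEmb_ge (L₀ := L₀) hn hd (by omega) hJE hJM
      (by rw [← hθ, ← hρ]; exact hρ1) q
    rw [← hθ, ← hρ] at hmain
    have hden : (1 / 4 : ℝ) ≤ (1 - ρ) ^ 2 := by nlinarith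
    have hfrac : 8 * ρ / (1 - ρ) ^ 2 ≤ 32 * ρ := by
      rw [div_le_iff₀ (by positivity)]
      nlinarith
    have h128 : 32 * ρ = 128 * 19 ^ 6 * θ := by rw [hρ]; ring
    linarith
  · push Not at hsmall
    have hneg : 1 - 128 * 19 ^ 6 * θ ≤ -1 := by nlinarith
    have hge : -1 ≤ polyakovCorrelation (L₀ := L₀) (znRep n) JE JM (planeEmb d q) := by
      have h := abs_polyakovCorrelation_le (znRep n) (continuous_znRep n) (znRep_mem_unitaryGroup n) JE JM
        (d := d) (L₀ := L₀) (L := L) (planeEmb d q)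
      have h1 : ((1 : ℕ) : ℝ) ^ 2 = 1 := by norm_num
      rw [h1] at h
      exact (abs_le.1 h).1
    linarith

end Correlation

/-! ### 6. Long-range order: deconfinement at every temporal extent, every `d ≥ 2`, every `n ≥ 2` -/

section LongRangeOrder

variable {n : ℕ}

/-- `e^{-J δ} < 1/C` when `J δ > log C` (`C > 0`). [folklore] -/
private theorem const_mul_exp_lt_one {C J δ : ℝ} (hC : 0 < C) (h : Real.log C < J * δ) :
    C * Real.exp (-(J * δ)) < 1 := by
  have h1 : Real.exp (-(J * δ)) < Real.exp (-Real.log C) := Real.exp_lt_exp.2 (by linarith)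
  rw [Real.exp_neg (Real.log C), Real.exp_log hC] at h1
  have h2 := mul_lt_mul_of_pos_left h1 hC
  rwa [mul_inv_cancel₀ hC.ne'] at h2

/-- **Every thermodynamic limit of the `ℤ_n` Polyakov correlation is bounded below on a coordinate
axis by Peierls' bound**: for `n ≥ 2`, `d ≥ 2`, `L₀ ≥ 1`, `J_E, J_M ≥ 0`, every (even periodic box,
subsequential) thermodynamic limit `G∞` satisfies `G∞(m e_0) ≥ 1 - 128·19⁶·L₀·n·e^{-J_E(1-cos(2π/n))}`
for all `m ∈ ℤ`. [cite: BorgsSeiler1983, §IV (p. 358)] [cite: Peierls1936] -/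
theorem _root_.Literature.MathematicalPhysics.QuantumFieldTheory.zn_thermodynamicLimit_axis_ge (hn : 2 ≤ n)
    (hd : 2 ≤ d) (L₀ : ℕ) [NeZero L₀] {JE JM : ℝ} (hJE : 0 ≤ JE) (hJM : 0 ≤ JM)
    {Ginf : (Fin d → ℤ) → ℝ} (hG : IsThermodynamicLimit (d := d) (L₀ := L₀) (znRep n) JE JM Ginf) (m : ℤ) :
    1 - 128 * 19 ^ 6 * ((L₀ : ℝ) * ((n : ℝ) * Real.exp (-(JE * znActionGap n)))) ≤
      Ginf (Pi.single (Fin.castLE hd 0) m) := by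
  obtain ⟨φ, hφ, hlim⟩ := hG
  have hev : ∀ᶠ k : ℕ in atTop, 1 ≤ φ k :=
    eventually_atTop.2 ⟨1, fun k hk => hk.trans (hφ.id_le k)⟩
  refine ge_of_tendsto (hlim _) ?_
  filter_upwards [hev] with k hk
  haveI : NeZero (2 * φ k + 2) := ⟨by omega⟩
  rw [planeEmb_single_zero hd m]
  exact zn_polyakovCorrelation_ge (L₀ := L₀) hn hd (by omega) hJE hJM _

/-- ★ **Deconfinement of `ℤ_n` lattice gauge theory at every temporal extent, in every space dimension
`d ≥ 2`** (`n ≥ 2`): for `J_E ≥ 0` with `J_E (1 - cos(2π/n)) > log(128·19⁶·L₀·n)` and every `J_M ≥ 0`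
the Polyakov loops have long-range order — every thermodynamic limit is `≥ c > 0` on the whole coordinate
axis `ℤ e_0`, an infinite set, so it does not tend to `0` at infinity. Borgs–Seiler's abelian
deconfinement ("gauge groups `U(1)` (or `ℤ_N` …)", `d ≥ 3` by the infrared bound) by Peierls' argument
instead, which includes `d = 2` and gives a threshold logarithmic in `L₀`.
[cite: BorgsSeiler1983, §III.3 (p. 354); §IV (pp. 357–359)] [cite: Peierls1936] -/
theorem _root_.Literature.MathematicalPhysics.QuantumFieldTheory.zn_hasPolyakovLongRangeOrder_of_two_le
    (hn : 2 ≤ n) (hd : 2 ≤ d) (L₀ : ℕ) [NeZero L₀] {JE JM : ℝ} (hJE : 0 ≤ JE) (hJM : 0 ≤ JM)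
    (hJ : Real.log (128 * 19 ^ 6 * ((L₀ : ℝ) * n)) < JE * znActionGap n) :
    HasPolyakovLongRangeOrder d L₀ (znRep n) JE JM := by
  intro Ginf hG hzero
  set c : ℝ := 1 - 128 * 19 ^ 6 * ((L₀ : ℝ) * ((n : ℝ) * Real.exp (-(JE * znActionGap n)))) with hc
  have hL₀ : (0 : ℝ) < L₀ := by exact_mod_cast Nat.pos_of_ne_zero (NeZero.ne L₀)
  have hn' : (0 : ℝ) < n := by exact_mod_cast (show 0 < n by omega)
  have hcpos : 0 < c := by
    have h := const_mul_exp_lt_one (by positivity : (0 : ℝ) < 128 * 19 ^ 6 * ((L₀ : ℝ) * n)) hJ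
    have : 128 * 19 ^ 6 * ((L₀ : ℝ) * ((n : ℝ) * Real.exp (-(JE * znActionGap n)))) =
        128 * 19 ^ 6 * ((L₀ : ℝ) * n) * Real.exp (-(JE * znActionGap n)) := by ring
    rw [hc, this]; linarith
  have hge : ∀ m : ℤ, c ≤ Ginf (Pi.single (Fin.castLE hd 0) m) := fun m =>
    zn_thermodynamicLimit_axis_ge hn hd L₀ hJE hJM hG m
  have hlt : ∀ᶠ x in cofinite, Ginf x < c := (tendsto_order.1 hzero).2 c hcpos
  have hfin : {x : Fin d → ℤ | ¬ Ginf x < c}.Finite := Filter.eventually_cofinite.1 hlt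
  have hsub : Set.range (fun m : ℤ => (Pi.single (Fin.castLE hd 0) m : Fin d → ℤ)) ⊆
      {x : Fin d → ℤ | ¬ Ginf x < c} := by
    rintro _ ⟨m, rfl⟩; exact not_lt.2 (hge m)
  have hinj : Function.Injective (fun m : ℤ => (Pi.single (Fin.castLE hd 0) m : Fin d → ℤ)) := by
    intro a b h
    have := congrFun h (Fin.castLE hd 0)
    simpa using this
  have hinf : (Set.range (fun m : ℤ => (Pi.single (Fin.castLE hd 0) m : Fin d → ℤ))).Infinite :=
    Set.infinite_range_of_injective hinj
  exact hinf (hfin.subset hsub)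

/-- **Deconfinement at every temporal extent — explicit threshold in `J_E`**: for `n ≥ 2`, `d ≥ 2`,
every `L₀ ≥ 1`, all `J_E ≥ (log(128·19⁶·L₀·n) + 1)/(1 - cos(2π/n))` and all `J_M ≥ 0` the Polyakov
loops of the `ℤ_n` theory have long-range order. [cite: BorgsSeiler1983, §III.3 (p. 354); §IV (pp. 357–359)] [cite: Peierls1936] -/
theorem _root_.Literature.MathematicalPhysics.QuantumFieldTheory.zn_hasPolyakovLongRangeOrder_of_two_le_of_ge
    (hn : 2 ≤ n) (hd : 2 ≤ d) (L₀ : ℕ) [NeZero L₀] {JE JM : ℝ}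
    (hJE : (Real.log (128 * 19 ^ 6 * ((L₀ : ℝ) * n)) + 1) / znActionGap n ≤ JE) (hJM : 0 ≤ JM) :
    HasPolyakovLongRangeOrder d L₀ (znRep n) JE JM := by
  have hδ := znActionGap_pos hn
  have hL₀ : (1 : ℝ) ≤ L₀ := by exact_mod_cast Nat.one_le_iff_ne_zero.2 (NeZero.ne L₀)
  have hn' : (2 : ℝ) ≤ n := by exact_mod_cast hn
  have hlog : 0 ≤ Real.log (128 * 19 ^ 6 * ((L₀ : ℝ) * n)) := Real.log_nonneg (by nlinarith)
  have hJE0 : 0 ≤ JE := le_trans (by positivity) hJE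
  refine zn_hasPolyakovLongRangeOrder_of_two_le hn hd L₀ hJE0 hJM ?_
  have h := (div_le_iff₀ hδ).1 hJE
  linarith

/-- ★ **Deconfinement of `ℤ_n` lattice gauge theory in `d + 1 ≥ 3` dimensions at every temporal
extent** (existential form, the shape of `FiniteTemperatureDeconfinement` for `ℤ_n` and `d ≥ 2`):
`∃ J₀ > 0` (namely `(log(128·19⁶·L₀·n) + 1)/(1 - cos(2π/n))`) with Polyakov long-range order for all
`J_E ≥ J₀`, `J_M ≥ 0`. In `d = 2` this is new relative to the tree (`zn_finiteTemperatureDeconfinement` is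
`d ≥ 3`); for `d ≥ 3` it improves the threshold from linear to logarithmic in `L₀`.
[cite: BorgsSeiler1983, §III.3 (p. 354); §IV (pp. 357–359)] [cite: Peierls1936] -/
theorem _root_.Literature.MathematicalPhysics.QuantumFieldTheory.zn_finiteTemperatureDeconfinement_of_two_le
    (hn : 2 ≤ n) (hd : 2 ≤ d) (L₀ : ℕ) [NeZero L₀] :
    ∃ J₀ : ℝ, 0 < J₀ ∧ ∀ JE JM : ℝ, J₀ ≤ JE → 0 ≤ JM →
      HasPolyakovLongRangeOrder d L₀ (znRep n) JE JM := by
  have hδ := znActionGap_pos hn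
  have hL₀ : (1 : ℝ) ≤ L₀ := by exact_mod_cast Nat.one_le_iff_ne_zero.2 (NeZero.ne L₀)
  have hn' : (2 : ℝ) ≤ n := by exact_mod_cast hn
  have hlog : 0 ≤ Real.log (128 * 19 ^ 6 * ((L₀ : ℝ) * n)) := Real.log_nonneg (by nlinarith)
  exact ⟨(Real.log (128 * 19 ^ 6 * ((L₀ : ℝ) * n)) + 1) / znActionGap n, by positivity,
    fun JE JM hJE hJM => zn_hasPolyakovLongRangeOrder_of_two_le_of_ge hn hd L₀ hJE hJM⟩

/-! #### Barrier corollaries in every space dimension `d ≥ 2` -/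

/-- **`ℤ_n` (`n ≥ 2`): Polyakov confinement at all couplings is FALSE at every temporal extent `L₀`, in
every space dimension `d ≥ 2`** (the tree's `zn_not_polyakovConfinementAtAllCouplings` is `d ≥ 3`).
[cite: BorgsSeiler1983, §IV (pp. 357–359)] -/
theorem _root_.Literature.MathematicalPhysics.QuantumFieldTheory.zn_not_polyakovConfinementAtAllCouplings_of_two_le
    (hn : 2 ≤ n) (hd : 2 ≤ d) (L₀ : ℕ) [NeZero L₀] :
    ¬ PolyakovConfinementAtAllCouplings d L₀ (znRep n) := by
  intro h
  obtain ⟨J₀, hJ₀, hLRO⟩ := zn_finiteTemperatureDeconfinement_of_two_le hn hd L₀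
  obtain ⟨Ginf, hG⟩ := exists_isThermodynamicLimit (d := d) (L₀ := L₀) (znRep n)
    (continuous_znRep n) (znRep_mem_unitaryGroup n) J₀ 1
  exact hLRO J₀ 1 le_rfl zero_le_one Ginf hG (h J₀ 1 hJ₀ one_pos Ginf hG)

/-- **`ℤ_n`: temperature-blind Polyakov confinement is FALSE in every space dimension `d ≥ 2`.**
[cite: BorgsSeiler1983, §IV (pp. 357–359)] -/
theorem _root_.Literature.MathematicalPhysics.QuantumFieldTheory.zn_not_temperatureBlindPolyakovConfinement_of_two_le
    (hn : 2 ≤ n) (hd : 2 ≤ d) : ¬ TemperatureBlindPolyakovConfinement d (znRep n) :=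
  fun h => zn_not_polyakovConfinementAtAllCouplings_of_two_le hn hd 1 (h 1)

/-- **`ℤ_n`: volume-uniform exponential clustering of the Polyakov correlation at all couplings is
FALSE at every temporal extent, in every space dimension `d ≥ 2`.**
[cite: BorgsSeiler1983, §II.4 (II.55)–(II.56) (p. 343); §IV (pp. 357–359)] -/
theorem _root_.Literature.MathematicalPhysics.QuantumFieldTheory.zn_not_uniformClusteringAtAllCouplings_of_two_le
    (hn : 2 ≤ n) (hd : 2 ≤ d) (L₀ : ℕ) [NeZero L₀] : ¬ UniformClusteringAtAllCouplings d L₀ (znRep n) :=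
  fun h => zn_not_polyakovConfinementAtAllCouplings_of_two_le hn hd L₀ h.polyakovConfinement

/-- **`ℤ_n`: temperature-blind volume-uniform clustering is FALSE in every space dimension `d ≥ 2`.**
[cite: BorgsSeiler1983, §IV (pp. 357–359)] -/
theorem _root_.Literature.MathematicalPhysics.QuantumFieldTheory.zn_not_temperatureBlindUniformClustering_of_two_le
    (hn : 2 ≤ n) (hd : 2 ≤ d) : ¬ TemperatureBlindUniformClustering d (znRep n) :=
  fun h => zn_not_temperatureBlindPolyakovConfinement_of_two_le hn hd h.polyakovConfinement

/-! #### Two-sided windows in every space dimension `d ≥ 2` -/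

/-- **The two-sided window for the `ℤ_n` finite-temperature transition, `n` even, every `d ≥ 2`**
(every `L₀`): no Polyakov long-range order for `0 ≤ J_E < β_c(d)`, `J_M ≥ 0` (the central `-1`, tree
`zn_criticalBeta_le_of_even_of_hasPolyakovLongRangeOrder`); long-range order for
`J_E (1 - cos(2π/n)) > log(128·19⁶·L₀·n)`, `J_M ≥ 0` (this file). The planar entry of the tree's
`zn_transition_window_of_even` (`d ≥ 3`). [cite: BorgsSeiler1983, §III.3 (p. 354); §IV (pp. 358–359)] -/
theorem _root_.Literature.MathematicalPhysics.QuantumFieldTheory.zn_transition_window_of_even_of_two_le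
    (hd : 2 ≤ d) (hn2 : 2 ≤ n) (hn : 2 ∣ n) (L₀ : ℕ) [NeZero L₀] :
    (∀ JE JM : ℝ, 0 ≤ JE → JE < criticalBeta d → 0 ≤ JM →
      ¬ HasPolyakovLongRangeOrder d L₀ (znRep n) JE JM) ∧
    (∀ JE JM : ℝ, 0 ≤ JE → Real.log (128 * 19 ^ 6 * ((L₀ : ℝ) * n)) < JE * znActionGap n → 0 ≤ JM →
      HasPolyakovLongRangeOrder d L₀ (znRep n) JE JM) :=
  ⟨fun _ _ hJE hJEc hJM h =>
      absurd (zn_criticalBeta_le_of_even_of_hasPolyakovLongRangeOrder hd hn L₀ hJE hJM h) (not_le.2 hJEc),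
    fun _ _ hJE hJ hJM => zn_hasPolyakovLongRangeOrder_of_two_le hn2 hd L₀ hJE hJM hJ⟩

/-- **The two-sided window for the `ℤ_n` finite-temperature transition, `n` odd `≥ 3`, every `d ≥ 2`**
(every `L₀`): no Polyakov long-range order for `0 ≤ J_E` with `2d(e^{2J_E} - 1) < 1`, `J_M ≥ 0` (tree
`zn_htRate_ge_one_of_hasPolyakovLongRangeOrder`, clock-layer high-temperature expansion); long-range
order for `J_E (1 - cos(2π/n)) > log(128·19⁶·L₀·n)`, `J_M ≥ 0` (this file). The planar entry of the
tree's `zn_transition_window_of_odd` (`d ≥ 3`). [cite: BorgsSeiler1983, §III.3 (p. 354); §II.4 (II.55) (p. 343); §IV (pp. 358–359)] -/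
theorem _root_.Literature.MathematicalPhysics.QuantumFieldTheory.zn_transition_window_of_odd_of_two_le
    (hd : 2 ≤ d) (hn : Odd n) (hn3 : 3 ≤ n) (L₀ : ℕ) [NeZero L₀] :
    (∀ JE JM : ℝ, 0 ≤ JE → htRate d JE < 1 → 0 ≤ JM → ¬ HasPolyakovLongRangeOrder d L₀ (znRep n) JE JM) ∧
    (∀ JE JM : ℝ, 0 ≤ JE → Real.log (128 * 19 ^ 6 * ((L₀ : ℝ) * n)) < JE * znActionGap n → 0 ≤ JM →
      HasPolyakovLongRangeOrder d L₀ (znRep n) JE JM) :=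
  ⟨fun _ _ hJE hr hJM h => absurd (zn_htRate_ge_one_of_hasPolyakovLongRangeOrder hn hn3 L₀ hJE hJM h) (not_le.2 hr),
    fun _ _ hJE hJ hJM => zn_hasPolyakovLongRangeOrder_of_two_le (by omega) hd L₀ hJE hJM hJ⟩

end LongRangeOrder

end ZnThermal

end Literature.MathematicalPhysics.QuantumFieldTheory

end
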